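import Summits.QuantumFields.YangMills.Theorems.BalabanUVNodesN11Sect3SupplyChainBorelB
import Summits.QuantumFields.YangMills.Theorems.BalabanUVNodesN11Sect3SupplyChainNode
import Summits.QuantumFields.YangMills.Theorems.BalabanUVNodesN11SpaceTruncationSameWitness

/-!
# DAG node N11 — BOREL 𝐁-TERMS ALONG THE WITNESS CHAIN, II: the positive-scale Borel-ness of the chain's boundary terms needs NO hypothesis on the base (the splices never
# copy the base's terms at scales `j ≥ 1`), and — at a Gaussian certificate — dag-n11-e's `NoExpansionObligation θ p σ` ∕ THEOREM 1 along the chain from `SupplierBorel`,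
# the supplier's obligations and the reading-line primitives, once dag-n11-d's SAME-WITNESS door (d4) face is in the tree; the same at the NAMED certificate `gaussPinH θ`
# (no class hypothesis) and at the H-extensions of the witness of record (selector, admissibility, signs, `M = 1` discharged)

HEADER — WORK-UNIT METADATA.  Cell `pub-ymgap`, YM-PLAN Track A (D-0062 ∕ D-0149 width seats), seat `pub-ymgap-dag-n11-w1` (g0; WIDTH SEAT 1 of 4 on NODE n11 [B14]),
route `BalabanUVNodes` rev 25, item K1⁷ `StabilityBAtRecordR13SepCoPH` = stmt-QuantumFields-20542 (helper, `--kind proof --supports 20542 --as helper`, count-neutral).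
dag-n11-e g16's HAND-OUT W1-X1 (iii)∕(iv).  [III] = [Balaban1988Convergent].  Over this seat's p596175 `…N11Sect3SupplyChainBorelB` (`SupplierBorel`, `borelB_spliceTermsB`), dag-n11-e's
`…N11Sect3SupplyChainObligationsDefs` (`ChainFormAt`, `SupplierObligations`, `NoExpansionObligation`, `sLaw₁₃CoPH_all_of_obligations`) and `…N11Sect3SupplyChainNode`
(`sLaw₁₃CoPH_all_theta13LiveOfRecordH_of_obligations`), this seat's `…N11GaussianCertificateDefs` (`gaussPinH`) ∕ `…Rows` (the class theorems), dag-n11-d's `…SpaceTruncationSameWitness`.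

WHAT THIS FILE PROVES (7 theorems, 0 `sorry`, 0 `def`; nothing of Bałaban asserted).
§1 ★★ `borelB_chainWitness_pos_of_supplierBorel`: for `1 ≤ j ≤ k` the chain's level-`k` boundary term `𝐁^{(j)}` is jointly Borel in `(U, A)` from `SupplierBorel` ALONE — the shape
   of dag-n11-d's weakened `hBt` (ANSWER-(β), `1 ≤ j ≤ k`); no `BaseBorel`.
§2 ★★★ `noExpansionObligation_of_gaussCert_of_supplierBorel_of_bgReadCharged` (W1-X1 (iii)): dag-n11-e's `NoExpansionObligation θ p σ` at any Gaussian-class `θ` from `SupplierBorel`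
   and the reading-line primitives (window; `RegOn` at parents and children; `BgProvisoΛ` over the CHARGED reading supports at both levels), through
   dag-n11-d's SAME-WITNESS door (d4) face `…SpaceTruncationSameWitness.clause_succ_sameWitness_of_hasSect2FormAtZS_of_borelB_of_bgReadCharged`; ★★★★
   `sLaw₁₃CoPH_all_of_obligations_of_gaussCert_of_supplierBorel_of_bgReadCharged` (W1-X1 (iv)): THEOREM 1 along the chain from `SupplierObligations` + `SupplierBorel` + the
   primitives — no operand row, no term bound, no (K0b) row, no residual row; `s2.Pos` is read off admissibility (`hθ.toStage12.pos`), not displayed.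
§3 ★★★ `noExpansionObligation_gaussPinH_of_supplierBorel_of_bgReadCharged` ∕ ★★★★ `sLaw₁₃CoPH_all_gaussPinH_of_obligations_of_supplierBorel_of_bgReadCharged`: §2 at the NAMED
   certificate `gaussPinH θ` — NO class hypothesis (`gaussPinH_ζ0` ∕ `gaussPinH_quad` are `rfl`, `provisos₁₃CoPH_gaussPinH`); ★★★
   `sLaw₁₃CoPH_all_gaussCertH_theta13LiveOfRecord_of_obligations_of_supplierBorel_of_bgReadCharged` (class form) ∕ ★★★★
   `sLaw₁₃CoPH_all_gaussPinH_theta13LiveOfRecordH_of_obligations_of_supplierBorel_of_bgReadCharged` (named form): THEOREM 1 along the chain at (the Gaussian certificate of) any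
   H-extension `⟨⟨θ₁₃, Zr⟩, Zh, Phih⟩` of the witness of record, with the selector clause (`rfl`), admissibility (`admissible_theta13LiveOfRecord`), `0 ≤ κ, E₀, B₀` and `M = 1`
   DISCHARGED — displayed: `hrec`, the window, 12a″'s `RegOn` (parents + children), def-R's `BgProvisoΛ` over the charged reading supports (levels `k`, `k+1`), the supplier with
   `SupplierObligations` + `SupplierBorel`.  The `SupplierBorel` twins of dag-n11-e's `…SupplyChainNode.sLaw₁₃CoPH_all_gaussCertH_theta13LiveOfRecord_of_obligations_of_operandRows`.

HONEST FRAMING.  Helper lane of K1⁷; kernel bookkeeping; nothing of Bałaban asserted.  N11 NOT discharged; K1⁷ NOT closed; counts unmoved (typed 28∕28 · discharged 5∕27).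
R4 closes only the conditional finite-𝕋⁴ rung `BalabanLadder.UV` of one programme at fixed `ε = L^{−K}` — NOT ℝ⁴, NOT OS, NOT a mass gap, NOT Clay.  No `sorry`, `axiom`, `instance`, `notation`.
Sources (SHAPE only): [III] Thm 1 p.262, §3 p.279, (2.40)–(2.41) p.261, (3.24)–(3.25) p.270.
-/

noncomputable section

open MeasureTheory
open scoped BigOperators ENNReal NNReal Matrix.Norms.L2Operator

namespace Summit.QuantumFields.YangMills.Theorems.BalabanUVNodesN11Sect3SupplyChainBorelBObligations

open Literature.MathematicalPhysics.QuantumFieldTheory.Balaban1983to89 T4Continuum Node00 Node00.Tk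
open B15DeterminingSets B8Eq17ClassAkV1 Step
open B10Eq42TorusConstraint (bondsIn)
open BalabanUVNodesN11HistoryPinnedResidualDefs (ZhPinOfRecord₁₃)
open BalabanUVNodesN11FluctTruncationDefs (IsFluctLocal)
open BalabanUVNodesN11Sect3SupplySpliceDefs (graftAbove zeroRB dropBFrom)
open BalabanUVNodesN11Sect3SupplySpliceOwnBoundary (graftAboveB)
open BalabanUVNodesN11Sect3SupplyChainDefs
open BalabanUVNodesN11Sect3SupplyChainBorelB
open BalabanUVNodesN11Sect3SupplyChainObligationsDefs
open BalabanUVNodesN11Sect3SupplyChainNode (sLaw₁₃CoPH_all_theta13LiveOfRecordH_of_obligations)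
open BalabanUVNodesN11GaussianCertificateRows
open BalabanUVNodesN11GaussianCertificateDefs (gaussPinH gaussPinH_ζ0 gaussPinH_quad provisos₁₃CoPH_gaussPinH)
open Literature.MathematicalPhysics.QuantumFieldTheory.Balaban1983to89.B16RLeafRecord13AtLive (kappa_nonneg_theta13LiveOfFamily B0_nonneg_theta13LiveOfFamily
  E0_nonneg_theta13LiveOfFamily)
open BalabanUVNodesN11AFibreDominationOfCoercive (afibre_rows_adm_of_coercive)

variable {F : T4Family} {N : ℕ} [NeZero N]

/-! ## §1  Positive scales: the chain's boundary terms are Borel from the supplier alone -/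

section Pos

variable {θ : Stage13HParams F N} {p : B12.RunParams}

/-- **★★ THE CHAIN WITNESS HAS JOINTLY BOREL BOUNDARY TERMS AT EVERY SCALE `1 ≤ j ≤ k` FROM `SupplierBorel` ALONE**: the splices copy the OLD terms only below the
current level and the base contributes only scale `0`, so by induction on `k` every `𝐁^{(j)}`, `1 ≤ j ≤ k`, of `chainWitness θ p σ k` is a supplier's term or zero.  The shape of
dag-n11-d's `hBt` row in its weakened form (`1 ≤ j ≤ k`); no hypothesis on `baseWitness`. [cite: Balaban1988Convergent, Thm 1 p.262, §3 p.279, (3.24)–(3.25) p.270 (bookkeeping)] -/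
theorem borelB_chainWitness_pos_of_supplierBorel (σ : Sect3Supplier θ p) (hσ : SupplierBorel θ p σ) :
    ∀ (k : ℕ) (s₀ : SeqOfRecord F θ.ν θ.τ9.M (gOfRecord₁₃ F N θ.toStage13Params p) p.K k) (S' : ℕ → Set (Site (F.P p.K) 0)) (j : ℕ)
      (X : (Sect2.domSys (F.P p.K) θ.τ9.M j).Dom), 1 ≤ j → j ≤ k →
      Measurable (fun q : GaugeField (F.P p.K) 0 (SU N) × MSFluct (F.P p.K) (FluctV N) =>
        ((chainWitness θ p σ k).1 s₀).B j X (Sect2.ofBackgroundC (settingOfRecord₁₃ F N θ.toStage13Params p).ι q.1) (S', q.2)) := by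
  intro k
  induction k with
  | zero => intro s₀ S' j X h1 h0; omega
  | succ k ih =>
    intro s S' j X h1 hj
    classical
    show Measurable (fun q : GaugeField (F.P p.K) 0 (SU N) × MSFluct (F.P p.K) (FluctV N) =>
      (spliceTermsB θ p k (chainWitness θ p σ k).1 (σ k (chainWitness θ p σ k).1 (chainWitness θ p σ k).2).1 s).B j X
        (Sect2.ofBackgroundC (settingOfRecord₁₃ F N θ.toStage13Params p).ι q.1) (S', q.2))
    unfold spliceTermsB
    split_ifs with hΩ h0
    · -- no-expansion child: old terms at scales `≤ k`, zero above
      show Measurable (fun q : GaugeField (F.P p.K) 0 (SU N) × MSFluct (F.P p.K) (FluctV N) =>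
        if j ≤ k then ((chainWitness θ p σ k).1 s.init).B j X (Sect2.ofBackgroundC (settingOfRecord₁₃ F N θ.toStage13Params p).ι q.1) (S', q.2)
          else (zeroRB ((σ k (chainWitness θ p σ k).1 (chainWitness θ p σ k).2).1 s)).B j X (Sect2.ofBackgroundC (settingOfRecord₁₃ F N θ.toStage13Params p).ι q.1) (S', q.2))
      by_cases hjk : j ≤ k
      · simp only [if_pos hjk]; exact ih s.init S' j X h1 hjk
      · simp only [if_neg hjk]; exact measurable_const
    · -- 𝐓-absent expansion child: old terms below `k`, zero from `k` on
      show Measurable (fun q : GaugeField (F.P p.K) 0 (SU N) × MSFluct (F.P p.K) (FluctV N) =>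
        if j ≤ k then (dropBFrom k ((chainWitness θ p σ k).1 s.init)).B j X (Sect2.ofBackgroundC (settingOfRecord₁₃ F N θ.toStage13Params p).ι q.1) (S', q.2)
          else (zeroRB ((σ k (chainWitness θ p σ k).1 (chainWitness θ p σ k).2).1 s)).B j X (Sect2.ofBackgroundC (settingOfRecord₁₃ F N θ.toStage13Params p).ι q.1) (S', q.2))
      by_cases hjk : j ≤ k
      · simp only [if_pos hjk]
        show Measurable (fun q : GaugeField (F.P p.K) 0 (SU N) × MSFluct (F.P p.K) (FluctV N) =>
          if j < k then ((chainWitness θ p σ k).1 s.init).B j X (Sect2.ofBackgroundC (settingOfRecord₁₃ F N θ.toStage13Params p).ι q.1) (S', q.2) else 0)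
        by_cases hjk' : j < k
        · simp only [if_pos hjk']; exact ih s.init S' j X h1 hjk
        · simp only [if_neg hjk']; exact measurable_const
      · simp only [if_neg hjk]; exact measurable_const
    · -- 𝐓-present expansion child: old terms below `k`, the supplier's from `k` on
      show Measurable (fun q : GaugeField (F.P p.K) 0 (SU N) × MSFluct (F.P p.K) (FluctV N) =>
        if j < k then ((chainWitness θ p σ k).1 s.init).B j X (Sect2.ofBackgroundC (settingOfRecord₁₃ F N θ.toStage13Params p).ι q.1) (S', q.2)
          else ((σ k (chainWitness θ p σ k).1 (chainWitness θ p σ k).2).1 s).B j X (Sect2.ofBackgroundC (settingOfRecord₁₃ F N θ.toStage13Params p).ι q.1) (S', q.2))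
      by_cases hjk : j < k
      · simp only [if_pos hjk]; exact ih s.init S' j X h1 hjk.le
      · simp only [if_neg hjk]; exact hσ k s S' j X

end Pos


/-! ## §2  ★★★ dag-n11-e's `NoExpansionObligation` and THEOREM 1 along the chain at a Gaussian certificate — from `SupplierBorel` and the reading-line primitives -/

section Obligation

variable (θ : Stage13HParams F N) (p : B12.RunParams)

/-- **★★★ `NoExpansionObligation θ p σ` AT ANY `θ` OF THE GAUSSIAN CERTIFICATE CLASS FROM `SupplierBorel` AND THE READING-LINE PRIMITIVES ONLY** (W1-X1 (iii)): dag-n11-d's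
SAME-WITNESS door (d4) face `…SpaceTruncationSameWitness.clause_succ_sameWitness_of_hasSect2FormAtZS_of_borelB_of_bgReadCharged` at the chain's level-`k` witness (its `hBt` on
`[1, k]` by §1), with its per-child residual rows ((P), (V), `quad_k(∅) = 0`, locality, measurability) and (K0b) rows DISCHARGED by the Gaussian class (`…GaussianCertificateRows`
§1 + dag-n11-w4's `afibre_rows_adm_of_coercive`).  DISPLAYED: per level the run's window, 12a″'s `RegOn` at the parents and at the children, def-R's `BgProvisoΛ` over the CHARGED
reading supports of the parents (background of level `k`) and of the children (background of level `k+1`).  No operand row, no term bound, no locality row, no `BaseBorel`.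
[cite: Balaban1988Convergent, Theorem p.245, Thm 1 p.262, §3 p.279, (3.24)–(3.25) p.270, (2.10) p.256, (2.27)–(2.28) p.259] -/
theorem noExpansionObligation_of_gaussCert_of_supplierBorel_of_bgReadCharged
    (hζ : ∀ (p : B12.RunParams) (n : ℕ) (Ω Λ : ℕ → Set (Site (F.P p.K) 0)), (θ.Zh p n Ω Λ).ζ0 = (ZhPinOfRecord₁₃ θ.toStage13Params p Ω Λ).ζ0)
    (hq : ∀ (p : B12.RunParams) (n : ℕ) (Ω Λ : ℕ → Set (Site (F.P p.K) 0)) (j : ℕ) (Λ' : Set (Site (F.P p.K) 0)) (ω : MultiCfg (F.P p.K) (SU N) (FluctV N)),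
      (θ.Zh p n Ω Λ).quad j Λ' ω = ∑ b ∈ (Set.toFinite (bondsIn j (Λ'ᶜ ∩ Ω (j + 1)))).toFinset, ‖(ω j).2 b‖ ^ 2)
    (h : θ.Provisos₁₃CoPH F N) (hθ : θ.Admissible F N) (hM : 1 ≤ θ.τ9.M)
    (hw : ∀ k, k < p.K → Step.InInterval θ.γ k (gOfRecord₁₃ F N θ.toStage13Params p)) (cR : ℝ)
    (Γr : (n : ℕ) → SeqOfRecord F θ.ν θ.τ9.M (gOfRecord₁₃ F N θ.toStage13Params p) p.K n → ℕ → Set (Site (F.P p.K) 0) → Set (Site (F.P p.K) 0))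
    (hreg : ∀ (n : ℕ) (s₀ : SeqOfRecord F θ.ν θ.τ9.M (gOfRecord₁₃ F N θ.toStage13Params p) p.K n),
      (θ.zhAt p s₀).RegOn F N (FluctV N) θ.ν cR p (gOfRecord₁₃ F N θ.toStage13Params p) (Γr n s₀))
    (hbg : ∀ k, k < p.K → BgProvisoΛ F N p.K (settingOfRecord₁₃ F N θ.toStage13Params p) (θ.Rz p.K) θ.τ9.M k
      (fun s₀ => {Wc | slotsOfRecord F N θ.ν θ.τ9 (EOfRecord₁₃ F N θ.toStage13Params) (wOfRecord₉ F N θ.toStage9Params) θ.ppSel p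
          (gOfRecord₁₃ F N θ.toStage13Params p) k s₀ ≠ 0 ∧
        chiSeqOfRecord F N θ.ν θ.τ9.M (gOfRecord₁₃ F N θ.toStage13Params p) p.K k s₀ (Wc k) ≠ 0 ∧
        ∀ j, j < k → PlaqSmallOn (plaqsOf (pts j (Γr k s₀ j (s₀.Ω (j + 1))ᶜ))) (cR * epsOfRecord θ.ν (gOfRecord₁₃ F N θ.toStage13Params p) j) (Wc j)})
      (UbgOfRecord₁₃CoP F N θ.toStage13Params p k))
    (hbg' : ∀ k, k < p.K → BgProvisoΛ F N p.K (settingOfRecord₁₃ F N θ.toStage13Params p) (θ.Rz p.K) θ.τ9.M k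
      (fun s : SeqOfRecord F θ.ν θ.τ9.M (gOfRecord₁₃ F N θ.toStage13Params p) p.K (k + 1) =>
        {Wc | slotsTOfRecord F N θ.ν θ.τ9 (EOfRecord₁₃ F N θ.toStage13Params) (wOfRecord₉ F N θ.toStage9Params) θ.ppSel p
            (gOfRecord₁₃ F N θ.toStage13Params p) (k + 1) s ≠ 0 ∧
          chiSeqOfRecord F N θ.ν θ.τ9.M (gOfRecord₁₃ F N θ.toStage13Params p) p.K (k + 1) s (Wc (k + 1)) ≠ 0 ∧
          ∀ j, j < k + 1 → PlaqSmallOn (plaqsOf (pts j (Γr (k + 1) s j (s.Ω (j + 1))ᶜ))) (cR * epsOfRecord θ.ν (gOfRecord₁₃ F N θ.toStage13Params p) j) (Wc j)})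
      (UbgOfRecord₁₃CoP F N θ.toStage13Params p (k + 1)))
    (σ : Sect3Supplier θ p) (hσB : SupplierBorel θ p σ) :
    NoExpansionObligation θ p σ := fun k hk hform s hΩ =>
  BalabanUVNodesN11SpaceTruncationSameWitness.clause_succ_sameWitness_of_hasSect2FormAtZS_of_borelB_of_bgReadCharged θ p h (zhUnity_of_gaussCert θ hζ) hθ hθ.toStage12.pos hk hM
    (hw k hk) cR (Γr k) (hreg k) (hbg k hk) (chainWitness θ p σ k).1 (chainWitness θ p σ k).2 ((chainFormAt_iff σ k).1 hform)
    (fun s₀ S' j X h1 hj => borelB_chainWitness_pos_of_supplierBorel σ hσB k s₀ S' j X h1 hj) (Γr (k + 1)) (hreg (k + 1)) (hbg' k hk) s hΩ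
    (prefix_agree_of_gaussCert θ p hζ hq s hΩ) (ζ0_pin_of_gaussCert θ p hζ hk s hΩ) (quad_empty_pairCfgAt_of_gaussCert θ p hq s)
    (quad_local_of_gaussCert θ p hq s) (fun j Y => measurable_ζ0_of_gaussCert θ p hζ h s j Y) (fun j Λ' => measurable_quad_of_gaussCert θ p hq s j Λ')
    (afibre_rows_adm_of_coercive θ p s fun j => coercive_of_gaussCert θ p hq s j)

/-- **★★★★ THEOREM 1 OF [III] ALONG THE WITNESS CHAIN AT ANY `θ` OF THE GAUSSIAN CERTIFICATE CLASS — `∀ k ≤ K, SLaw₁₃CoPH θ p k` — FROM `SupplierObligations`, `SupplierBorel`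
AND THE READING-LINE PRIMITIVES** (W1-X1 (iv)): dag-n11-e's `sLaw₁₃CoPH_all_of_obligations` with its `NoExpansionObligation` DISCHARGED by the previous theorem (the supplier's
locality is `SupplierObligations.loc`).  On the live-selector line (core provisos, selector clause, admissibility, `0 ≤ κ, E₀, B₀`, `1 ≤ M`).  No operand row, no term bound,
no (K0b) row, no residual row. [cite: Balaban1988Convergent, Thm 1 p.262, Theorem p.245, §3 p.279, (3.24)–(3.25) p.270; Balaban1989LargeFieldI, (0.2)–(0.4) p.176, p.177 (i)–(ii)] -/
theorem sLaw₁₃CoPH_all_of_obligations_of_gaussCert_of_supplierBorel_of_bgReadCharged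
    (hζ : ∀ (p : B12.RunParams) (n : ℕ) (Ω Λ : ℕ → Set (Site (F.P p.K) 0)), (θ.Zh p n Ω Λ).ζ0 = (ZhPinOfRecord₁₃ θ.toStage13Params p Ω Λ).ζ0)
    (hq : ∀ (p : B12.RunParams) (n : ℕ) (Ω Λ : ℕ → Set (Site (F.P p.K) 0)) (j : ℕ) (Λ' : Set (Site (F.P p.K) 0)) (ω : MultiCfg (F.P p.K) (SU N) (FluctV N)),
      (θ.Zh p n Ω Λ).quad j Λ' ω = ∑ b ∈ (Set.toFinite (bondsIn j (Λ'ᶜ ∩ Ω (j + 1)))).toFinset, ‖(ω j).2 b‖ ^ 2)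
    (h : θ.Provisos₁₃CoPH F N)
    (hsel : θ.ppSel = ppSelLiveOfRecord F N θ.ν θ.τ9 (EOfRecord₁₃ F N θ.toStage13Params) (wOfRecord₉ F N θ.toStage9Params))
    (hθ : θ.Admissible F N) (hκ : 0 ≤ θ.s2.lf.κ) (hE₀ : 0 ≤ θ.s2.lf.E₀) (hB₀ : 0 ≤ θ.s2.lf.B₀) (hM : 1 ≤ θ.τ9.M)
    (hw : ∀ k, k < p.K → Step.InInterval θ.γ k (gOfRecord₁₃ F N θ.toStage13Params p)) (cR : ℝ)
    (Γr : (n : ℕ) → SeqOfRecord F θ.ν θ.τ9.M (gOfRecord₁₃ F N θ.toStage13Params p) p.K n → ℕ → Set (Site (F.P p.K) 0) → Set (Site (F.P p.K) 0))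
    (hreg : ∀ (n : ℕ) (s₀ : SeqOfRecord F θ.ν θ.τ9.M (gOfRecord₁₃ F N θ.toStage13Params p) p.K n),
      (θ.zhAt p s₀).RegOn F N (FluctV N) θ.ν cR p (gOfRecord₁₃ F N θ.toStage13Params p) (Γr n s₀))
    (hbg : ∀ k, k < p.K → BgProvisoΛ F N p.K (settingOfRecord₁₃ F N θ.toStage13Params p) (θ.Rz p.K) θ.τ9.M k
      (fun s₀ => {Wc | slotsOfRecord F N θ.ν θ.τ9 (EOfRecord₁₃ F N θ.toStage13Params) (wOfRecord₉ F N θ.toStage9Params) θ.ppSel p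
          (gOfRecord₁₃ F N θ.toStage13Params p) k s₀ ≠ 0 ∧
        chiSeqOfRecord F N θ.ν θ.τ9.M (gOfRecord₁₃ F N θ.toStage13Params p) p.K k s₀ (Wc k) ≠ 0 ∧
        ∀ j, j < k → PlaqSmallOn (plaqsOf (pts j (Γr k s₀ j (s₀.Ω (j + 1))ᶜ))) (cR * epsOfRecord θ.ν (gOfRecord₁₃ F N θ.toStage13Params p) j) (Wc j)})
      (UbgOfRecord₁₃CoP F N θ.toStage13Params p k))
    (hbg' : ∀ k, k < p.K → BgProvisoΛ F N p.K (settingOfRecord₁₃ F N θ.toStage13Params p) (θ.Rz p.K) θ.τ9.M k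
      (fun s : SeqOfRecord F θ.ν θ.τ9.M (gOfRecord₁₃ F N θ.toStage13Params p) p.K (k + 1) =>
        {Wc | slotsTOfRecord F N θ.ν θ.τ9 (EOfRecord₁₃ F N θ.toStage13Params) (wOfRecord₉ F N θ.toStage9Params) θ.ppSel p
            (gOfRecord₁₃ F N θ.toStage13Params p) (k + 1) s ≠ 0 ∧
          chiSeqOfRecord F N θ.ν θ.τ9.M (gOfRecord₁₃ F N θ.toStage13Params p) p.K (k + 1) s (Wc (k + 1)) ≠ 0 ∧
          ∀ j, j < k + 1 → PlaqSmallOn (plaqsOf (pts j (Γr (k + 1) s j (s.Ω (j + 1))ᶜ))) (cR * epsOfRecord θ.ν (gOfRecord₁₃ F N θ.toStage13Params p) j) (Wc j)})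
      (UbgOfRecord₁₃CoP F N θ.toStage13Params p (k + 1)))
    (σ : Sect3Supplier θ p) (hσ : SupplierObligations θ p σ) (hσB : SupplierBorel θ p σ) :
    ∀ k, k ≤ p.K → SLaw₁₃CoPH F N θ p k :=
  sLaw₁₃CoPH_all_of_obligations h hsel hθ hκ hE₀ hB₀ hM σ hσ
    (noExpansionObligation_of_gaussCert_of_supplierBorel_of_bgReadCharged θ p hζ hq h hθ hM hw cR Γr hreg hbg hbg' σ hσB)

end Obligation


/-! ## §3  At the NAMED Gaussian certificate `gaussPinH θ` (no class hypothesis), and at the H-extensions of the witness of record (selector, admissibility, signs, `M = 1` discharged) -/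

section Named

variable (θ : Stage13HParams F N) (p : B12.RunParams)

/-- **★★★ `NoExpansionObligation (gaussPinH θ) p σ` — AT THE NAMED GAUSSIAN CERTIFICATE, NO CLASS HYPOTHESIS**: §2 at `gaussPinH θ` (its `ζ0` ∕ `quad` rows are `rfl`:
`gaussPinH_ζ0`, `gaussPinH_quad`; the core provisos transfer by `provisos₁₃CoPH_gaussPinH`).  Hypotheses in `θ`'s vocabulary (the certificate shares `θ.toStage13RParams`);
12a″'s `RegOn` is read at the certificate's `zhAt`. [cite: Balaban1988Convergent, Theorem p.245, Thm 1 p.262, §3 p.279, (3.24)–(3.25) p.270, (2.27)–(2.28) p.259] -/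
theorem noExpansionObligation_gaussPinH_of_supplierBorel_of_bgReadCharged (h : θ.Provisos₁₃CoPH F N) (hθ : θ.Admissible F N) (hM : 1 ≤ θ.τ9.M)
    (hw : ∀ k, k < p.K → Step.InInterval θ.toStage13Params.γ k (gOfRecord₁₃ F N θ.toStage13Params p)) (cR : ℝ)
    (Γr : (n : ℕ) → SeqOfRecord F θ.toStage13Params.ν θ.toStage13Params.τ9.M (gOfRecord₁₃ F N θ.toStage13Params p) p.K n → ℕ → Set (Site (F.P p.K) 0) → Set (Site (F.P p.K) 0))
    (hreg : ∀ (n : ℕ) (s₀ : SeqOfRecord F θ.toStage13Params.ν θ.toStage13Params.τ9.M (gOfRecord₁₃ F N θ.toStage13Params p) p.K n),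
      ((gaussPinH θ).zhAt p s₀).RegOn F N (FluctV N) θ.toStage13Params.ν cR p (gOfRecord₁₃ F N θ.toStage13Params p) (Γr n s₀))
    (hbg : ∀ k, k < p.K → BgProvisoΛ F N p.K (settingOfRecord₁₃ F N θ.toStage13Params p) (θ.toStage13Params.Rz p.K) θ.toStage13Params.τ9.M k
      (fun s₀ => {Wc | slotsOfRecord F N θ.toStage13Params.ν θ.toStage13Params.τ9 (EOfRecord₁₃ F N θ.toStage13Params) (wOfRecord₉ F N θ.toStage13Params.toStage9Params) θ.toStage13Params.ppSel p
          (gOfRecord₁₃ F N θ.toStage13Params p) k s₀ ≠ 0 ∧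
        chiSeqOfRecord F N θ.toStage13Params.ν θ.toStage13Params.τ9.M (gOfRecord₁₃ F N θ.toStage13Params p) p.K k s₀ (Wc k) ≠ 0 ∧
        ∀ j, j < k → PlaqSmallOn (plaqsOf (pts j (Γr k s₀ j (s₀.Ω (j + 1))ᶜ))) (cR * epsOfRecord θ.toStage13Params.ν (gOfRecord₁₃ F N θ.toStage13Params p) j) (Wc j)})
      (UbgOfRecord₁₃CoP F N θ.toStage13Params p k))
    (hbg' : ∀ k, k < p.K → BgProvisoΛ F N p.K (settingOfRecord₁₃ F N θ.toStage13Params p) (θ.toStage13Params.Rz p.K) θ.toStage13Params.τ9.M k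
      (fun s : SeqOfRecord F θ.toStage13Params.ν θ.toStage13Params.τ9.M (gOfRecord₁₃ F N θ.toStage13Params p) p.K (k + 1) =>
        {Wc | slotsTOfRecord F N θ.toStage13Params.ν θ.toStage13Params.τ9 (EOfRecord₁₃ F N θ.toStage13Params) (wOfRecord₉ F N θ.toStage13Params.toStage9Params) θ.toStage13Params.ppSel p
            (gOfRecord₁₃ F N θ.toStage13Params p) (k + 1) s ≠ 0 ∧
          chiSeqOfRecord F N θ.toStage13Params.ν θ.toStage13Params.τ9.M (gOfRecord₁₃ F N θ.toStage13Params p) p.K (k + 1) s (Wc (k + 1)) ≠ 0 ∧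
          ∀ j, j < k + 1 → PlaqSmallOn (plaqsOf (pts j (Γr (k + 1) s j (s.Ω (j + 1))ᶜ))) (cR * epsOfRecord θ.toStage13Params.ν (gOfRecord₁₃ F N θ.toStage13Params p) j) (Wc j)})
      (UbgOfRecord₁₃CoP F N θ.toStage13Params p (k + 1)))
    (σ : Sect3Supplier (gaussPinH θ) p) (hσB : SupplierBorel (gaussPinH θ) p σ) :
    NoExpansionObligation (gaussPinH θ) p σ :=
  noExpansionObligation_of_gaussCert_of_supplierBorel_of_bgReadCharged (gaussPinH θ) p (gaussPinH_ζ0 θ) (gaussPinH_quad θ) (provisos₁₃CoPH_gaussPinH h) hθ hM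
    hw cR Γr hreg hbg hbg' σ hσB

/-- **★★★★ THEOREM 1 OF [III] ALONG THE CHAIN AT THE NAMED GAUSSIAN CERTIFICATE `gaussPinH θ` — `∀ k ≤ K, SLaw₁₃CoPH (gaussPinH θ) p k` — FROM `SupplierObligations`,
`SupplierBorel` AND THE READING-LINE PRIMITIVES, NO CLASS HYPOTHESIS** (§2's THEOREM 1 at the named witness; live-selector line of `θ`).
[cite: Balaban1988Convergent, Thm 1 p.262, Theorem p.245, §3 p.279, (3.24)–(3.25) p.270; Balaban1989LargeFieldI, (0.2)–(0.4) p.176, p.177 (i)–(ii)] -/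
theorem sLaw₁₃CoPH_all_gaussPinH_of_obligations_of_supplierBorel_of_bgReadCharged (h : θ.Provisos₁₃CoPH F N)
    (hsel : θ.ppSel = ppSelLiveOfRecord F N θ.ν θ.τ9 (EOfRecord₁₃ F N θ.toStage13Params) (wOfRecord₉ F N θ.toStage9Params))
    (hθ : θ.Admissible F N) (hκ : 0 ≤ θ.s2.lf.κ) (hE₀ : 0 ≤ θ.s2.lf.E₀) (hB₀ : 0 ≤ θ.s2.lf.B₀) (hM : 1 ≤ θ.τ9.M)
    (hw : ∀ k, k < p.K → Step.InInterval θ.toStage13Params.γ k (gOfRecord₁₃ F N θ.toStage13Params p)) (cR : ℝ)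
    (Γr : (n : ℕ) → SeqOfRecord F θ.toStage13Params.ν θ.toStage13Params.τ9.M (gOfRecord₁₃ F N θ.toStage13Params p) p.K n → ℕ → Set (Site (F.P p.K) 0) → Set (Site (F.P p.K) 0))
    (hreg : ∀ (n : ℕ) (s₀ : SeqOfRecord F θ.toStage13Params.ν θ.toStage13Params.τ9.M (gOfRecord₁₃ F N θ.toStage13Params p) p.K n),
      ((gaussPinH θ).zhAt p s₀).RegOn F N (FluctV N) θ.toStage13Params.ν cR p (gOfRecord₁₃ F N θ.toStage13Params p) (Γr n s₀))
    (hbg : ∀ k, k < p.K → BgProvisoΛ F N p.K (settingOfRecord₁₃ F N θ.toStage13Params p) (θ.toStage13Params.Rz p.K) θ.toStage13Params.τ9.M k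
      (fun s₀ => {Wc | slotsOfRecord F N θ.toStage13Params.ν θ.toStage13Params.τ9 (EOfRecord₁₃ F N θ.toStage13Params) (wOfRecord₉ F N θ.toStage13Params.toStage9Params) θ.toStage13Params.ppSel p
          (gOfRecord₁₃ F N θ.toStage13Params p) k s₀ ≠ 0 ∧
        chiSeqOfRecord F N θ.toStage13Params.ν θ.toStage13Params.τ9.M (gOfRecord₁₃ F N θ.toStage13Params p) p.K k s₀ (Wc k) ≠ 0 ∧
        ∀ j, j < k → PlaqSmallOn (plaqsOf (pts j (Γr k s₀ j (s₀.Ω (j + 1))ᶜ))) (cR * epsOfRecord θ.toStage13Params.ν (gOfRecord₁₃ F N θ.toStage13Params p) j) (Wc j)})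
      (UbgOfRecord₁₃CoP F N θ.toStage13Params p k))
    (hbg' : ∀ k, k < p.K → BgProvisoΛ F N p.K (settingOfRecord₁₃ F N θ.toStage13Params p) (θ.toStage13Params.Rz p.K) θ.toStage13Params.τ9.M k
      (fun s : SeqOfRecord F θ.toStage13Params.ν θ.toStage13Params.τ9.M (gOfRecord₁₃ F N θ.toStage13Params p) p.K (k + 1) =>
        {Wc | slotsTOfRecord F N θ.toStage13Params.ν θ.toStage13Params.τ9 (EOfRecord₁₃ F N θ.toStage13Params) (wOfRecord₉ F N θ.toStage13Params.toStage9Params) θ.toStage13Params.ppSel p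
            (gOfRecord₁₃ F N θ.toStage13Params p) (k + 1) s ≠ 0 ∧
          chiSeqOfRecord F N θ.toStage13Params.ν θ.toStage13Params.τ9.M (gOfRecord₁₃ F N θ.toStage13Params p) p.K (k + 1) s (Wc (k + 1)) ≠ 0 ∧
          ∀ j, j < k + 1 → PlaqSmallOn (plaqsOf (pts j (Γr (k + 1) s j (s.Ω (j + 1))ᶜ))) (cR * epsOfRecord θ.toStage13Params.ν (gOfRecord₁₃ F N θ.toStage13Params p) j) (Wc j)})
      (UbgOfRecord₁₃CoP F N θ.toStage13Params p (k + 1)))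
    (σ : Sect3Supplier (gaussPinH θ) p) (hσ : SupplierObligations (gaussPinH θ) p σ) (hσB : SupplierBorel (gaussPinH θ) p σ) :
    ∀ k, k ≤ p.K → SLaw₁₃CoPH F N (gaussPinH θ) p k :=
  sLaw₁₃CoPH_all_of_obligations_of_gaussCert_of_supplierBorel_of_bgReadCharged (gaussPinH θ) p (gaussPinH_ζ0 θ) (gaussPinH_quad θ) (provisos₁₃CoPH_gaussPinH h)
    hsel hθ hκ hE₀ hB₀ hM hw cR Γr hreg hbg hbg' σ hσ hσB

end Named

section Record

variable (F N)
variable {Zr : (q : B12.RunParams) → TkResidualW F N (FluctV N) q.K}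
  {Zh : (q : B12.RunParams) → ℕ → (ℕ → Set (Site (F.P q.K) 0)) → (ℕ → Set (Site (F.P q.K) 0)) → TkResidualW F N (FluctV N) q.K}
  {Phih : (q : B12.RunParams) → ℕ → (ℕ → Set (Site (F.P q.K) 0)) → (ℕ → Set (Site (F.P q.K) 0)) → (ℕ → Plaq (F.P q.K) 0 → ℝ)} (p : B12.RunParams)

/-- **★★★ THEOREM 1 OF [III] ALONG THE CHAIN AT ANY GAUSSIAN-CLASS H-EXTENSION `⟨⟨θ₁₃, Zr⟩, Zh, Phih⟩` OF THE WITNESS OF RECORD — FROM `hrec`, THE WINDOW, THE READING-LINE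
PRIMITIVES, `SupplierObligations` AND `SupplierBorel`** (selector clause `rfl`, admissibility, `s2.Pos` and `M = 1` DISCHARGED at the record; the `SupplierBorel` twin of
dag-n11-e's `…SupplyChainNode.sLaw₁₃CoPH_all_gaussCertH_theta13LiveOfRecord_of_obligations_of_operandRows`).
[cite: Balaban1988Convergent, Thm 1 p.262, Theorem p.245, §3 p.279, (3.24)–(3.25) p.270; Balaban1989LargeFieldI, (0.3)–(0.4) p.176, p.177 (i)–(ii)] -/
theorem sLaw₁₃CoPH_all_gaussCertH_theta13LiveOfRecord_of_obligations_of_supplierBorel_of_bgReadCharged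
    (hζ : ∀ (p : B12.RunParams) (n : ℕ) (Ω Λ : ℕ → Set (Site (F.P p.K) 0)), (Zh p n Ω Λ).ζ0 = (ZhPinOfRecord₁₃ (theta13LiveOfRecord F N) p Ω Λ).ζ0)
    (hq : ∀ (p : B12.RunParams) (n : ℕ) (Ω Λ : ℕ → Set (Site (F.P p.K) 0)) (j : ℕ) (Λ' : Set (Site (F.P p.K) 0)) (ω : MultiCfg (F.P p.K) (SU N) (FluctV N)),
      (Zh p n Ω Λ).quad j Λ' ω = ∑ b ∈ (Set.toFinite (bondsIn j (Λ'ᶜ ∩ Ω (j + 1)))).toFinset, ‖(ω j).2 b‖ ^ 2)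
    (hrec : (⟨⟨theta13LiveOfRecord F N, Zr⟩, Zh, Phih⟩ : Stage13HParams F N).Provisos₁₃CoPH F N)
    (hw : ∀ k, k < p.K → Step.InInterval (theta13LiveOfRecord F N).γ k (gOfRecord₁₃ F N (theta13LiveOfRecord F N) p)) (cR : ℝ)
    (Γr : (n : ℕ) → SeqOfRecord F (theta13LiveOfRecord F N).ν (theta13LiveOfRecord F N).τ9.M (gOfRecord₁₃ F N (theta13LiveOfRecord F N) p) p.K n → ℕ → Set (Site (F.P p.K) 0) → Set (Site (F.P p.K) 0))
    (hreg : ∀ (n : ℕ) (s₀ : SeqOfRecord F (theta13LiveOfRecord F N).ν (theta13LiveOfRecord F N).τ9.M (gOfRecord₁₃ F N (theta13LiveOfRecord F N) p) p.K n),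
      ((⟨⟨theta13LiveOfRecord F N, Zr⟩, Zh, Phih⟩ : Stage13HParams F N).zhAt p s₀).RegOn F N (FluctV N) (theta13LiveOfRecord F N).ν cR p (gOfRecord₁₃ F N (theta13LiveOfRecord F N) p) (Γr n s₀))
    (hbg : ∀ k, k < p.K → BgProvisoΛ F N p.K (settingOfRecord₁₃ F N (theta13LiveOfRecord F N) p) ((theta13LiveOfRecord F N).Rz p.K) (theta13LiveOfRecord F N).τ9.M k
      (fun s₀ => {Wc | slotsOfRecord F N (theta13LiveOfRecord F N).ν (theta13LiveOfRecord F N).τ9 (EOfRecord₁₃ F N (theta13LiveOfRecord F N)) (wOfRecord₉ F N (theta13LiveOfRecord F N).toStage9Params) (theta13LiveOfRecord F N).ppSel p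
          (gOfRecord₁₃ F N (theta13LiveOfRecord F N) p) k s₀ ≠ 0 ∧
        chiSeqOfRecord F N (theta13LiveOfRecord F N).ν (theta13LiveOfRecord F N).τ9.M (gOfRecord₁₃ F N (theta13LiveOfRecord F N) p) p.K k s₀ (Wc k) ≠ 0 ∧
        ∀ j, j < k → PlaqSmallOn (plaqsOf (pts j (Γr k s₀ j (s₀.Ω (j + 1))ᶜ))) (cR * epsOfRecord (theta13LiveOfRecord F N).ν (gOfRecord₁₃ F N (theta13LiveOfRecord F N) p) j) (Wc j)})
      (UbgOfRecord₁₃CoP F N (theta13LiveOfRecord F N) p k))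
    (hbg' : ∀ k, k < p.K → BgProvisoΛ F N p.K (settingOfRecord₁₃ F N (theta13LiveOfRecord F N) p) ((theta13LiveOfRecord F N).Rz p.K) (theta13LiveOfRecord F N).τ9.M k
      (fun s : SeqOfRecord F (theta13LiveOfRecord F N).ν (theta13LiveOfRecord F N).τ9.M (gOfRecord₁₃ F N (theta13LiveOfRecord F N) p) p.K (k + 1) =>
        {Wc | slotsTOfRecord F N (theta13LiveOfRecord F N).ν (theta13LiveOfRecord F N).τ9 (EOfRecord₁₃ F N (theta13LiveOfRecord F N)) (wOfRecord₉ F N (theta13LiveOfRecord F N).toStage9Params) (theta13LiveOfRecord F N).ppSel p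
            (gOfRecord₁₃ F N (theta13LiveOfRecord F N) p) (k + 1) s ≠ 0 ∧
          chiSeqOfRecord F N (theta13LiveOfRecord F N).ν (theta13LiveOfRecord F N).τ9.M (gOfRecord₁₃ F N (theta13LiveOfRecord F N) p) p.K (k + 1) s (Wc (k + 1)) ≠ 0 ∧
          ∀ j, j < k + 1 → PlaqSmallOn (plaqsOf (pts j (Γr (k + 1) s j (s.Ω (j + 1))ᶜ))) (cR * epsOfRecord (theta13LiveOfRecord F N).ν (gOfRecord₁₃ F N (theta13LiveOfRecord F N) p) j) (Wc j)})
      (UbgOfRecord₁₃CoP F N (theta13LiveOfRecord F N) p (k + 1)))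
    (σ : Sect3Supplier (⟨⟨theta13LiveOfRecord F N, Zr⟩, Zh, Phih⟩ : Stage13HParams F N) p)
    (hσ : SupplierObligations (⟨⟨theta13LiveOfRecord F N, Zr⟩, Zh, Phih⟩ : Stage13HParams F N) p σ)
    (hσB : SupplierBorel (⟨⟨theta13LiveOfRecord F N, Zr⟩, Zh, Phih⟩ : Stage13HParams F N) p σ) :
    ∀ k, k ≤ p.K → SLaw₁₃CoPH F N (⟨⟨theta13LiveOfRecord F N, Zr⟩, Zh, Phih⟩ : Stage13HParams F N) p k :=
  sLaw₁₃CoPH_all_theta13LiveOfRecordH_of_obligations F N p hrec σ hσ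
    (noExpansionObligation_of_gaussCert_of_supplierBorel_of_bgReadCharged (⟨⟨theta13LiveOfRecord F N, Zr⟩, Zh, Phih⟩ : Stage13HParams F N) p hζ hq hrec
      (admissible_theta13LiveOfRecord F N) (le_of_eq rfl) hw cR Γr hreg hbg hbg' σ hσB)

/-- **★★★★ THEOREM 1 OF [III] ALONG THE CHAIN AT THE NAMED GAUSSIAN CERTIFICATE `gaussPinH ⟨⟨θ₁₃, Zr⟩, Zh, Phih⟩` OF ANY H-EXTENSION OF THE WITNESS OF RECORD — FROM `hrec`,
THE WINDOW, THE READING-LINE PRIMITIVES, `SupplierObligations` AND `SupplierBorel`; NO CLASS HYPOTHESIS; selector ∕ admissibility ∕ signs ∕ `M = 1` DISCHARGED.**  What stays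
DISPLAYED is exactly: the datum's key `hrec`, the run's window, 12a″'s `RegOn` at the certificate (parents and children), def-R's `BgProvisoΛ` over the charged reading supports
(levels `k` and `k+1`), and [III] §3's supplier with its obligations and the Borel-ness of its boundary terms.
[cite: Balaban1988Convergent, Thm 1 p.262, Theorem p.245, §3 p.279, (3.24)–(3.25) p.270; Balaban1989LargeFieldI, (0.3)–(0.4) p.176, p.177 (i)–(ii)] -/
theorem sLaw₁₃CoPH_all_gaussPinH_theta13LiveOfRecordH_of_obligations_of_supplierBorel_of_bgReadCharged
    (hrec : (⟨⟨theta13LiveOfRecord F N, Zr⟩, Zh, Phih⟩ : Stage13HParams F N).Provisos₁₃CoPH F N)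
    (hw : ∀ k, k < p.K → Step.InInterval (theta13LiveOfRecord F N).γ k (gOfRecord₁₃ F N (theta13LiveOfRecord F N) p)) (cR : ℝ)
    (Γr : (n : ℕ) → SeqOfRecord F (theta13LiveOfRecord F N).ν (theta13LiveOfRecord F N).τ9.M (gOfRecord₁₃ F N (theta13LiveOfRecord F N) p) p.K n → ℕ → Set (Site (F.P p.K) 0) → Set (Site (F.P p.K) 0))
    (hreg : ∀ (n : ℕ) (s₀ : SeqOfRecord F (theta13LiveOfRecord F N).ν (theta13LiveOfRecord F N).τ9.M (gOfRecord₁₃ F N (theta13LiveOfRecord F N) p) p.K n),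
      ((gaussPinH (⟨⟨theta13LiveOfRecord F N, Zr⟩, Zh, Phih⟩ : Stage13HParams F N)).zhAt p s₀).RegOn F N (FluctV N) (theta13LiveOfRecord F N).ν cR p (gOfRecord₁₃ F N (theta13LiveOfRecord F N) p) (Γr n s₀))
    (hbg : ∀ k, k < p.K → BgProvisoΛ F N p.K (settingOfRecord₁₃ F N (theta13LiveOfRecord F N) p) ((theta13LiveOfRecord F N).Rz p.K) (theta13LiveOfRecord F N).τ9.M k
      (fun s₀ => {Wc | slotsOfRecord F N (theta13LiveOfRecord F N).ν (theta13LiveOfRecord F N).τ9 (EOfRecord₁₃ F N (theta13LiveOfRecord F N)) (wOfRecord₉ F N (theta13LiveOfRecord F N).toStage9Params) (theta13LiveOfRecord F N).ppSel p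
          (gOfRecord₁₃ F N (theta13LiveOfRecord F N) p) k s₀ ≠ 0 ∧
        chiSeqOfRecord F N (theta13LiveOfRecord F N).ν (theta13LiveOfRecord F N).τ9.M (gOfRecord₁₃ F N (theta13LiveOfRecord F N) p) p.K k s₀ (Wc k) ≠ 0 ∧
        ∀ j, j < k → PlaqSmallOn (plaqsOf (pts j (Γr k s₀ j (s₀.Ω (j + 1))ᶜ))) (cR * epsOfRecord (theta13LiveOfRecord F N).ν (gOfRecord₁₃ F N (theta13LiveOfRecord F N) p) j) (Wc j)})
      (UbgOfRecord₁₃CoP F N (theta13LiveOfRecord F N) p k))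
    (hbg' : ∀ k, k < p.K → BgProvisoΛ F N p.K (settingOfRecord₁₃ F N (theta13LiveOfRecord F N) p) ((theta13LiveOfRecord F N).Rz p.K) (theta13LiveOfRecord F N).τ9.M k
      (fun s : SeqOfRecord F (theta13LiveOfRecord F N).ν (theta13LiveOfRecord F N).τ9.M (gOfRecord₁₃ F N (theta13LiveOfRecord F N) p) p.K (k + 1) =>
        {Wc | slotsTOfRecord F N (theta13LiveOfRecord F N).ν (theta13LiveOfRecord F N).τ9 (EOfRecord₁₃ F N (theta13LiveOfRecord F N)) (wOfRecord₉ F N (theta13LiveOfRecord F N).toStage9Params) (theta13LiveOfRecord F N).ppSel p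
            (gOfRecord₁₃ F N (theta13LiveOfRecord F N) p) (k + 1) s ≠ 0 ∧
          chiSeqOfRecord F N (theta13LiveOfRecord F N).ν (theta13LiveOfRecord F N).τ9.M (gOfRecord₁₃ F N (theta13LiveOfRecord F N) p) p.K (k + 1) s (Wc (k + 1)) ≠ 0 ∧
          ∀ j, j < k + 1 → PlaqSmallOn (plaqsOf (pts j (Γr (k + 1) s j (s.Ω (j + 1))ᶜ))) (cR * epsOfRecord (theta13LiveOfRecord F N).ν (gOfRecord₁₃ F N (theta13LiveOfRecord F N) p) j) (Wc j)})
      (UbgOfRecord₁₃CoP F N (theta13LiveOfRecord F N) p (k + 1)))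
    (σ : Sect3Supplier (gaussPinH (⟨⟨theta13LiveOfRecord F N, Zr⟩, Zh, Phih⟩ : Stage13HParams F N)) p)
    (hσ : SupplierObligations (gaussPinH (⟨⟨theta13LiveOfRecord F N, Zr⟩, Zh, Phih⟩ : Stage13HParams F N)) p σ)
    (hσB : SupplierBorel (gaussPinH (⟨⟨theta13LiveOfRecord F N, Zr⟩, Zh, Phih⟩ : Stage13HParams F N)) p σ) :
    ∀ k, k ≤ p.K → SLaw₁₃CoPH F N (gaussPinH (⟨⟨theta13LiveOfRecord F N, Zr⟩, Zh, Phih⟩ : Stage13HParams F N)) p k :=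
  sLaw₁₃CoPH_all_gaussPinH_of_obligations_of_supplierBorel_of_bgReadCharged (⟨⟨theta13LiveOfRecord F N, Zr⟩, Zh, Phih⟩ : Stage13HParams F N) p hrec rfl
    (admissible_theta13LiveOfRecord F N) (kappa_nonneg_theta13LiveOfFamily F N eps0OfRecord₁₃ (zeta316OfRecord F N (numerics7OfFamily eps0OfRecord₁₃) 1 1) (RzOfRecord F N) (ZtOfRecord F N))
    (E0_nonneg_theta13LiveOfFamily F N eps0OfRecord₁₃ (zeta316OfRecord F N (numerics7OfFamily eps0OfRecord₁₃) 1 1) (RzOfRecord F N) (ZtOfRecord F N)) (B0_nonneg_theta13LiveOfFamily F N eps0OfRecord₁₃ (zeta316OfRecord F N (numerics7OfFamily eps0OfRecord₁₃) 1 1) (RzOfRecord F N) (ZtOfRecord F N))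
    (le_of_eq rfl) hw cR Γr hreg hbg hbg' σ hσ hσB

end Record

end Summit.QuantumFields.YangMills.Theorems.BalabanUVNodesN11Sect3SupplyChainBorelBObligations

end
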